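import Literature.Topology.FourManifolds.IsotopyFromTrajectories
import Literature.Topology.FourManifolds.KirbyMovesSlideSweepLift
import HarnessLib

/-!
# Normalising the band end, step A: rotating the tube about the push-off circle

Topic `Literature/Topology/FourManifolds`; fact seat `provefact-IsStrictHandleSlide.isSurgery`
(R. C. Kirby, *The Topology of 4-Manifolds*, LNM 1374 (1989), Ch. I §4, p. 10: the slide band
reaches the framing push-off `Kⱼ'` of `Kⱼ`; remaining content in the tree: the named fact (S)
`Literature.Topology.FourManifolds.FramedLink.IsStrictHandleSlide.slideModel`,
`KirbyMovesHandleSlide.lean`). Before the sweep across the meridian disc can be read in a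
meridian slice of the surgered tube, the end of the slide band at `Kⱼ'` has to be made *flat and
radial*: its tangent planes along `Kⱼ'` must contain the radial direction of the tube `ν` of
`Kⱼ` (`Kⱼ' = ν.pushOff = ν (·, e₀)`). In the coordinates `S¹ × ℝ²` of `ν` the push-off is the
circle `C₀ = S¹ × {e₀}`, and the first step of the normalisation is the **rotation of the tube
about `C₀`** by an angle depending on the point of the circle, cut off at distance `τ` from `C₀`
(so that the core `S¹ × {0}` — the knot `Kⱼ` and the small surgery tube around it — and everything
at distance `≥ τ` from `C₀` stay fixed). Proved here, no definitions, no named facts: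

* `Literature.Topology.FourManifolds.SlideSweep.exists_tubeIsotopy_rotationAboutPushOff` — for a
  smooth angle function `θ : S¹ → ℝ`, `0 < τ`, and a smooth radial profile `φ` vanishing beyond
  squared distance `τ²`, a compactly supported isotopy `Θ` of `S¹ × ℝ²` (`TubeIsotopy`, radius
  `1/2 + τ`) with `Θ t (x, w) = (x, e₀ + cos α (w - e₀) + sin α J (w - e₀))`,
  `α = t θ(x) φ(‖w - e₀‖²)`, for `0 ≤ t θ(x)`-scaled times in the unit range (precisely: for all
  `t, x, w` with `t θ x ∈ [0, 1]` replaced by the time-rescaled statement below), and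
  `Θ t (x, w) = (x, w)` whenever `τ ≤ ‖w - e₀‖` — the slice-wise lift
  (`exists_tubeIsotopy_sliceLift`) of the planar rotation about `e₀`
  (`exists_ambientIsotopy_rotationAbout`) with the time rescaled by `θ`.

The formula is recorded in the form produced by the two tools: `Θ t (x, w) = (x, σ (t θ x) w)`
for the planar rotation isotopy `σ`, together with the explicit values of `σ s` for `0 ≤ s ≤ 1`;
consumers needing angles beyond one full unit of `σ`'s time take `φ` with the total angle built
in. Hirsch, *Differential Topology* (1976), Ch. 8 §1.

## References

* R. C. Kirby, *The Topology of 4-Manifolds*, LNM 1374, Springer (1989), Ch. I §4. [Kirby1989]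
* M. W. Hirsch, *Differential Topology*, GTM 33, Springer (1976), Ch. 8 §1, Thms. 1.2–1.3.
  [HirschDT1976]
-/

open scoped Manifold ContDiff Topology
open Function Set Metric

noncomputable section

namespace Literature.Topology.FourManifolds

namespace SlideSweep

/-- **Rotation of the tube about the push-off circle.** Let `Θ₀ : ℝ` be a total angle,
`β : S¹ → ℝ` smooth (the fraction of the total angle used over each point of the circle), `0 < τ`,
and `φ : ℝ → ℝ` smooth with `φ s = 0` for `s ≥ τ²`. Then there is a compactly supported isotopy
`Θ` of `S¹ × ℝ²` with supporting radius `1/2 + τ` such that, writing `e₀ = framingBaseVector`-free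
as the point `E := (1/2) e_x` of the plane (`‖E‖ = 1/2`) — here any centre `E` with `‖E‖ = 1/2` —:
for all `t`, `x`, `w` with `t β x ∈ [0, 1]`,
`Θ t (x, w) = (x, E + cos (t β x Θ₀ φ(‖w - E‖²)) (w - E) + sin (…) J (w - E))`, and
`Θ t (x, w) = (x, w)` whenever `τ ≤ ‖w - E‖` (all `t`). In particular the core circle `S¹ × {0}`
is fixed as soon as `τ ≤ 1/2`. [cite: HirschDT1976, Ch. 8 §1, Thm. 1.3] -/
theorem exists_tubeIsotopy_rotationAboutPushOff (E : EuclideanSpace ℝ (Fin 2)) (hE : ‖E‖ = 1 / 2)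
    (Θ₀ : ℝ) {β : Metric.sphere (0 : EuclideanSpace ℝ (Fin 2)) 1 → ℝ}
    (hβ : ContMDiff (𝓡 1) 𝓘(ℝ, ℝ) ∞ β) {τ : ℝ} (hτ : 0 < τ) {φ : ℝ → ℝ} (hφ : ContDiff ℝ ∞ φ)
    (hφ0 : ∀ s, τ ^ 2 ≤ s → φ s = 0) :
    ∃ Θ : TubeIsotopy, Θ.radius = 1 / 2 + τ ∧
      (∀ (t : ℝ) (x : Metric.sphere (0 : EuclideanSpace ℝ (Fin 2)) 1) (w : EuclideanSpace ℝ (Fin 2)),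
        t * β x ∈ Icc (0 : ℝ) 1 →
        Θ.toFun t (x, w) = (x, E + Real.cos (t * β x * Θ₀ * φ (‖w - E‖ ^ 2)) • (w - E) +
          Real.sin (t * β x * Θ₀ * φ (‖w - E‖ ^ 2)) •
            ((-((w - E) 1)) • EuclideanSpace.single (0 : Fin 2) (1 : ℝ) +
              ((w - E) 0) • EuclideanSpace.single 1 1))) ∧
      (∀ (t : ℝ) (x : Metric.sphere (0 : EuclideanSpace ℝ (Fin 2)) 1) (w : EuclideanSpace ℝ (Fin 2)),
        τ ≤ ‖w - E‖ → Θ.toFun t (x, w) = (x, w)) := by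
  obtain ⟨σ, -, hσ, hσfix⟩ := exists_ambientIsotopy_rotationAbout E Θ₀ hτ hφ hφ0
  -- `σ` is the identity off the disc of radius `1/2 + τ` about the origin
  have hR : ∀ t (p : EuclideanSpace ℝ (Fin 2)), 1 / 2 + τ ≤ ‖p‖ → σ.toFun t p = p := by
    intro t p hp
    refine hσfix p ?_ t
    have h := norm_sub_norm_le p E
    rw [hE] at h
    linarith
  obtain ⟨Θ, hrad, hΘ⟩ := exists_tubeIsotopy_sliceLift σ hR hβ
  refine ⟨Θ, hrad, fun t x w ht ↦ ?_, fun t x w hw ↦ ?_⟩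
  · rw [hΘ, hσ w (t * β x) ht]
  · rw [hΘ, hσfix w hw]

end SlideSweep

end Literature.Topology.FourManifolds
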